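import Mathlib
import HarnessLib

/-!
# `RationalShortRootRigidity` — Step 1 helper (§7 of the `stub_reduce` plan): Wick-hyperbolicity along the short root `½(1,1,1,1)`

Helper lemma INSIDE the paper proof of crux `stmt-QuantumFields-23124` (`F4SubCurvatureDoor.RationalShortRootRigidity`,
LINE g15-A of planner ym-idea-3; owner's assembly plan HOME l15/STUB-PLAN-Reduce.md §7):

**Lemma** (`wickAlong_half_of_wickAlong_e0`).  Let `D` be invariant (as a function on `ℝ⁴`) under the signed permutations and under
the half-reflection `s(p) = p − ½(Σpᵢ)(1,1,1,1)`, and Wick-hyperbolic along `e₀`.  Then `D` is Wick-hyperbolic along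
`half = ½(1,1,1,1)`.

Proof.  `g₀ := ε₁₂₃ ∘ s` (flip the signs of coordinates `1,2,3` after the half-reflection) is a linear isometry in `W(F₄)` with
`g₀(e₀) = half`; `D ∘ g₀ = D` as a POLYNOMIAL identity (`MvPolynomial.funext` from the two functional invariances), hence at complex
points (`MvPolynomial.aeval_bind₁`).  For `q′ ⊥ half` put `q″ := g₀⁻¹ q′ = s(ε₁₂₃ q′)`; then `q″ ⊥ e₀` and
`g₀(z e₀ + q″) = z·half + q′`, so `D(z·half + q′) = D(z e₀ + q″) = 0` forces `Re z = 0`.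

All hypotheses / conclusions are the birth skeleton's `IsB4Inv`, `IsHalfInv`, `WickAlong e0`, `WickAlong half` UNFOLDED exactly as in the
landed Step-2 theorem `stub_planar` (p672469).  Mathlib only; THEOREMS ONLY; no named facts; no `sorry`; default heartbeats.  Nothing about
the crux 23124, the route's rung or the Yang–Mills mass gap is proved here.  Free-hands width seat `ym-line-sfw-p2-w4` g18,
`--supports stmt-QuantumFields-23124`.
-/

set_option autoImplicit false

namespace Summit.QuantumFields.YangMills.Theorems.RationalShortRootRigidity

open scoped BigOperators

/-- **Wick-hyperbolicity along `½(1,1,1,1)` from Wick-hyperbolicity along `e₀`** (STUB-PLAN-Reduce §7). [folklore] -/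
theorem wickAlong_half_of_wickAlong_e0 (D : MvPolynomial (Fin 4) ℝ)
    (hB4 : ∀ (σ : Equiv.Perm (Fin 4)) (ε : Fin 4 → ℝ), (∀ i, ε i = 1 ∨ ε i = -1) →
      ∀ p : Fin 4 → ℝ, MvPolynomial.eval (fun i => ε i * p (σ i)) D = MvPolynomial.eval p D)
    (hHalf : ∀ p : Fin 4 → ℝ, MvPolynomial.eval (fun i => p i - (∑ j, p j) / 2) D = MvPolynomial.eval p D)
    (hWe0 : ∀ q : Fin 4 → ℝ, (∑ i, q i * (fun i : Fin 4 => if i = 0 then (1 : ℝ) else 0) i) = 0 →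
      ∀ z : ℂ, MvPolynomial.aeval (fun i => z * ((fun i : Fin 4 => if i = 0 then (1 : ℝ) else 0) i : ℂ) + (q i : ℂ)) D = 0 →
        z.re = 0) :
    ∀ q : Fin 4 → ℝ, (∑ i, q i * (fun _ : Fin 4 => (1 : ℝ) / 2) i) = 0 →
      ∀ z : ℂ, MvPolynomial.aeval (fun i => z * ((fun _ : Fin 4 => (1 : ℝ) / 2) i : ℂ) + (q i : ℂ)) D = 0 → z.re = 0 := by
  intro q hq z hz
  classical
  -- the sign vector `ε = (1, −1, −1, −1)` and the linear forms of `g₀ = ε ∘ s`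
  set ε : Fin 4 → ℝ := fun i => if i = 0 then 1 else -1 with hε
  have hεsign : ∀ i, ε i = 1 ∨ ε i = -1 := by
    intro i
    by_cases hi : i = 0
    · left; simp [hε, hi]
    · right; simp [hε, hi]
  set L : Fin 4 → MvPolynomial (Fin 4) ℝ := fun i =>
    MvPolynomial.C (ε i) * (MvPolynomial.X i - (∑ j : Fin 4, MvPolynomial.X j) * MvPolynomial.C (1 / 2 : ℝ)) with hL
  -- `D ∘ g₀ = D` as polynomials
  have hreal : ∀ p : Fin 4 → ℝ, MvPolynomial.eval (fun i => ε i * (p i - (∑ j, p j) / 2)) D = MvPolynomial.eval p D := by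
    intro p
    have h1 := hB4 (Equiv.refl _) ε hεsign (fun i => p i - (∑ j, p j) / 2)
    simp only [Equiv.refl_apply] at h1
    rw [h1]
    exact hHalf p
  have hpoly : MvPolynomial.bind₁ L D = D := by
    apply MvPolynomial.funext
    intro p
    rw [MvPolynomial.eval, MvPolynomial.eval₂Hom_bind₁]
    show MvPolynomial.eval (fun i => MvPolynomial.eval p (L i)) D = _
    have hLi : (fun i => MvPolynomial.eval p (L i)) = fun i => ε i * (p i - (∑ j, p j) / 2) := by
      funext i
      simp only [hL, map_mul, MvPolynomial.eval_C, map_sub, MvPolynomial.eval_X, map_sum]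
      ring
    rw [hLi]
    exact hreal p
  -- the complex point `z e₀ + q″` with `q″ = g₀⁻¹ q′`
  set q'' : Fin 4 → ℝ := fun i => ε i * q i - (∑ j, ε j * q j) / 2 with hq''
  have hsumq : q 0 + q 1 + q 2 + q 3 = 0 := by
    have h := hq
    simp only [Fin.sum_univ_four] at h
    linarith
  have hq''0 : q'' 0 = 0 := by
    simp only [hq'', hε, Fin.sum_univ_four]
    simp
    linarith
  have hperp : (∑ i, q'' i * (fun i : Fin 4 => if i = 0 then (1 : ℝ) else 0) i) = 0 := by
    simp only [Fin.sum_univ_four]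
    simp [hq''0]
  -- `g₀` applied to the complex point `v = z e₀ + q″` gives `z·half + q′`
  set v : Fin 4 → ℂ := fun i => z * ((fun i : Fin 4 => if i = 0 then (1 : ℝ) else 0) i : ℂ) + (q'' i : ℂ) with hv
  have hgv : ∀ i, MvPolynomial.aeval v (L i) = z * (((1 : ℝ) / 2 : ℝ) : ℂ) + (q i : ℂ) := by
    intro i
    simp only [hL, map_mul, MvPolynomial.aeval_C, map_sub, MvPolynomial.aeval_X, map_sum]
    fin_cases i <;> simp [hv, hq'', hε, Fin.sum_univ_four] <;> ring
  have hD : MvPolynomial.aeval v D = 0 := by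
    have h := congrArg (MvPolynomial.aeval v) hpoly
    rw [MvPolynomial.aeval_bind₁] at h
    rw [← h]
    have hfun : (fun i => MvPolynomial.aeval v (L i)) =
        fun i => z * ((fun _ : Fin 4 => (1 : ℝ) / 2) i : ℂ) + (q i : ℂ) := funext hgv
    rw [hfun]
    exact hz
  exact hWe0 q'' hperp z hD

end Summit.QuantumFields.YangMills.Theorems.RationalShortRootRigidity
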